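import Mathlib
import HarnessLib
import Summits.HubbardSuperconductivity.HubbardSuperconductivity.Theorems.KLProgrammePerturbedFermiCurveDefs

/-!
# Route `KLProgramme` — K3's ENGINE child (gen 4: `KLRegimeEngineV12`, stmt-HubbardSuperconductivity-19855), two-leg stubs
# `stub_twoLeg_scale0` / `stub_twoLeg_step`: the perturbed Fermi radius under TWO perturbations, and off the curve —
# the READING-POINT Lipschitz layer of (E3c) `FrameLipschitzG` and (E3e) `TwoLegSlopes` (BGM 2006 Lemma 2.1, order zero, two frames)

Cell `gate-hubbard-kl`, seat p1b (g6).  The two-leg slot of the K3 bundle reads the localised two-leg value of the scale-`n` action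
on the FRAME'S OWN Fermi curve, `ν_n(K)(θ) = S_n(klFermiPoint μ K θ)` (`…SplitTwoLegF`).  Two of its clauses compare readings at
DIFFERENT points of one ray: (E3c) `FrameLipschitzG` compares the frames `K` and `K′`, whose Fermi points `u_K(θ)·dir θ`,
`u_{K′}(θ)·dir θ` differ; (E3e) `TwoLegSlopes` compares the value at a shell momentum `s·dir θ` with the value at the curve point
`u_K(θ)·dir θ` of the same ray.  Both need, besides an engine bound on the reading function `S_n`, ONE geometric fact each about the
perturbed Fermi radius `u_δ(θ) = perturbedFermiRadius δ μ θ` of `{ε₀ + δ = μ}` (p4's `…H10TwoPointLimitPerturbedFermiRadius`, BGM 2006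
Lemma 2.1 at order zero, there for ONE perturbation against the free curve):

* §1 **two perturbations** `δ, δ′` with `|δ|, |δ′| ≤ κ₀` on the closed square, `[μ − κ₀, μ + κ₀] ⊂ [a, b]`, `δ` radially `κ₁`-Lipschitz
  on the ray: any two roots satisfy `(Dt_min − κ₁)·|t − t′| ≤ |δ(t′·dir θ) − δ′(t′·dir θ)|` (`mul_abs_sub_le_of_shifted_two`) — p4's
  uniqueness mechanism `shifted_unique` run with two perturbations (`Dt_min (t′ − t) ≤ ε₀(t′) − ε₀(t) = δ(t) − δ′(t′)`); hence
  **`|u_δ(θ) − u_{δ′}(θ)| ≤ sup|δ − δ′| / (Dt_min − κ₁)`** (`abs_perturbedFermiRadius_sub_le`);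
* §2 **off the curve**: for a point `s·dir θ` of the ray whose free level lies in `[a, b]`,
  `(Dt_min − κ₁)·|s − t| ≤ |ε₀(s·dir θ) + δ(s·dir θ) − μ|` (`mul_abs_sub_le_abs_level_of_shifted`) — the radial distance to the curve
  is controlled by the value of the perturbed level function (radial transversality), named form `abs_sub_perturbedFermiRadius_le_abs_level`;
* §3 the two READING inequalities for a function `F` radially `b`-Lipschitz on the ray: two frames
  `|F(u_δ·dir θ) − F′(u_{δ′}·dir θ)| ≤ |F(u_{δ′}·dir θ) − F′(u_{δ′}·dir θ)| + b·sup|δ − δ′|/(Dt_min − κ₁)`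
  (`abs_apply_sub_apply_le_of_two_perturbations`), and off-curve `|F(s·dir θ) − F(u_δ·dir θ)| ≤ b·|ε₀ + δ − μ|(s·dir θ)/(Dt_min − κ₁)`
  (`abs_apply_sub_apply_perturbedFermiRadius_le`); the radial Lipschitz hypothesis of `F` comes from a gradient bound on the
  closed square by p4's `radialLipschitz_of_fderiv_le` (not restated).

Frame-keyed forms (`klFermiPoint μ K`, `frameDist K K′`, `nambuXiCT`, the shell) are the companion `…KLRegimeSplitTwoLegReadingSlopes`.
Everything is PROVED; no definitions, no named facts; nothing about the Hubbard model is asserted.  References: BGM 2006 §2.4 Lemma 2.1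
(2.40) [cite: BenfattoGiulianiMastropietro2006]; FST IV (CPAM 53 (2000) 1350) §1 (the reading point moves with the frame).
-/

noncomputable section

namespace Summit.HubbardSuperconductivity.HubbardSuperconductivity.Theorems.PerturbedFermiCurve

set_option linter.dupNamespace false -- summit = problem name (single-conjunct summit), D-0017

open Real Set
open Literature.MathematicalPhysics.QuantumLattice Literature.MathematicalPhysics.QuantumLattice.BandSectorCounting

/-! ## §1 Two perturbations on one ray -/

/-- **Two perturbations, two roots** (BGM 2006 Lemma 2.1's monotonicity step with two perturbations): if `|δ|, |δ′| ≤ κ₀` on the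
closed square, `[μ − κ₀, μ + κ₀] ⊂ [a, b]`, and `δ` is radially `κ₁`-Lipschitz on the segment of the ray `θ`, then a Fermi point `t` of
`ε₀ + δ` and a Fermi point `t′` of `ε₀ + δ′` at level `μ` on that ray satisfy
`(Dt_min − κ₁)·|t − t′| ≤ |δ(t′·dir θ) − δ′(t′·dir θ)|`: for `t ≤ t′`,
`Dt_min (t′ − t) ≤ ε₀(t′·dir θ) − ε₀(t·dir θ) = δ(t·dir θ) − δ′(t′·dir θ) ≤ κ₁ (t′ − t) + (δ − δ′)(t′·dir θ)`, and symmetrically.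
[cite: BenfattoGiulianiMastropietro2006, §2.4 Lemma 2.1] -/
theorem mul_abs_sub_le_of_shifted_two {a b : ℝ} (B : BandBounds a b) {δ δ' : (Fin 2 → ℝ) → ℝ} {κ₀ κ₁ μ θ : ℝ}
    (hδ : ∀ k : Fin 2 → ℝ, (∀ i, |k i| ≤ π) → |δ k| ≤ κ₀) (hδ' : ∀ k : Fin 2 → ℝ, (∀ i, |k i| ≤ π) → |δ' k| ≤ κ₀)
    (hlo : a ≤ μ - κ₀) (hhi : μ + κ₀ ≤ b)
    (hL : ∀ s t : ℝ, s ∈ Icc 0 (π / ‖dir θ‖) → t ∈ Icc 0 (π / ‖dir θ‖) →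
      |δ (s • dir θ) - δ (t • dir θ)| ≤ κ₁ * |s - t|)
    {t t' : ℝ} (ht : IsBandFermiRadius (μ - δ (t • dir θ)) θ t) (ht' : IsBandFermiRadius (μ - δ' (t' • dir θ)) θ t') :
    (B.Dtmin - κ₁) * |t - t'| ≤ |δ (t' • dir θ) - δ' (t' • dir θ)| := by
  have hm := shiftedLevel_mem_Icc ht hδ hlo hhi
  have hm' := shiftedLevel_mem_Icc ht' hδ' hlo hhi
  have hlip := abs_le.1 (hL t t' ht.mem_Icc ht'.mem_Icc)
  have hD1 := le_abs_self (δ (t' • dir θ) - δ' (t' • dir θ))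
  have hD2 := neg_le_abs (δ (t' • dir θ) - δ' (t' • dir θ))
  rcases le_total t t' with h | h
  · have hgrow := Dtmin_mul_sub_le_rayDispersion_sub B ht.1.1 h ht'.1.2
      (by rw [ht.2]; exact hm.1) (by rw [ht'.2]; exact hm'.2)
    rw [ht.2, ht'.2] at hgrow
    have habs : |t - t'| = -(t - t') := abs_of_nonpos (sub_nonpos.2 h)
    rw [habs] at hlip ⊢
    nlinarith [hlip.1, hlip.2]
  · have hgrow := Dtmin_mul_sub_le_rayDispersion_sub B ht'.1.1 h ht.1.2
      (by rw [ht'.2]; exact hm'.1) (by rw [ht.2]; exact hm.2)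
    rw [ht.2, ht'.2] at hgrow
    have habs : |t - t'| = t - t' := abs_of_nonneg (sub_nonneg.2 h)
    rw [habs] at hlip ⊢
    nlinarith [hlip.1, hlip.2]

section TwoPerturbations

variable {a b : ℝ} (B : BandBounds a b) {δ δ' : (Fin 2 → ℝ) → ℝ} (hδc : Continuous δ) (hδc' : Continuous δ')
  {κ₀ κ₁ μ : ℝ} (hδ : ∀ k : Fin 2 → ℝ, (∀ i, |k i| ≤ π) → |δ k| ≤ κ₀)
  (hδ' : ∀ k : Fin 2 → ℝ, (∀ i, |k i| ≤ π) → |δ' k| ≤ κ₀) (hlo : a ≤ μ - κ₀) (hhi : μ + κ₀ ≤ b) {θ : ℝ}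
  (hL : ∀ s t : ℝ, s ∈ Icc 0 (π / ‖dir θ‖) → t ∈ Icc 0 (π / ‖dir θ‖) →
    |δ (s • dir θ) - δ (t • dir θ)| ≤ κ₁ * |s - t|)
  (hκ₁ : κ₁ < B.Dtmin) {d : ℝ} (hd : ∀ k : Fin 2 → ℝ, (∀ i, |k i| ≤ π) → |δ k - δ' k| ≤ d)
include B hδc hδc' hδ hδ' hlo hhi hL hκ₁ hd

/-- **The perturbed Fermi radius is `1/(Dt_min − κ₁)`-Lipschitz in the perturbation** (sup norm on the closed square): for `δ, δ′`
continuous with `|δ|, |δ′| ≤ κ₀` there, `[μ − κ₀, μ + κ₀] ⊂ [a, b]`, `δ` radially `κ₁`-Lipschitz on the ray with `κ₁ < Dt_min`, and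
`|δ − δ′| ≤ d` on the closed square, `|u_δ(θ) − u_{δ′}(θ)| ≤ d / (Dt_min − κ₁)`.  (With `δ = −K`, `δ′ = −K′` and `d = frameDist K K′`
this is the motion of the reading point `klFermiPoint μ K θ` under a change of frame, the geometric half of (E3c).)
[cite: BenfattoGiulianiMastropietro2006, §2.4 Lemma 2.1 (2.40)] -/
theorem abs_perturbedFermiRadius_sub_le :
    |perturbedFermiRadius δ μ θ - perturbedFermiRadius δ' μ θ| ≤ d / (B.Dtmin - κ₁) := by
  have ht := isBandFermiRadius_perturbedFermiRadius B hδc hδ hlo hhi θ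
  have ht' := isBandFermiRadius_perturbedFermiRadius B hδc' hδ' hlo hhi θ
  have h := mul_abs_sub_le_of_shifted_two B hδ hδ' hlo hhi hL ht ht'
  rw [le_div_iff₀ (sub_pos.2 hκ₁), mul_comm]
  exact h.trans (hd _ (abs_apply_le_pi_of_isBandFermiRadius ht'))

/-- **Reading a radially Lipschitz function at the Fermi points of two perturbations**: if `F` is radially `b_F`-Lipschitz on the
segment of the ray `θ` (`b_F ≥ 0`), then
`|F(u_δ(θ)·dir θ) − F′(u_{δ′}(θ)·dir θ)| ≤ |F(u_{δ′}(θ)·dir θ) − F′(u_{δ′}(θ)·dir θ)| + b_F·d/(Dt_min − κ₁)` for ANY second function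
`F′` — the comparison of two readings splits into «same point, two functions» (the engine's frame-derivative of the reading function)
plus «one function, two points» (this file).  [folklore] -/
theorem abs_apply_sub_apply_le_of_two_perturbations {F F' : (Fin 2 → ℝ) → ℝ} {bF : ℝ} (hbF : 0 ≤ bF)
    (hF : ∀ s t : ℝ, s ∈ Icc 0 (π / ‖dir θ‖) → t ∈ Icc 0 (π / ‖dir θ‖) →
      |F (s • dir θ) - F (t • dir θ)| ≤ bF * |s - t|) :
    |F (perturbedFermiRadius δ μ θ • dir θ) - F' (perturbedFermiRadius δ' μ θ • dir θ)| ≤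
      |F (perturbedFermiRadius δ' μ θ • dir θ) - F' (perturbedFermiRadius δ' μ θ • dir θ)| +
        bF * (d / (B.Dtmin - κ₁)) := by
  have ht := isBandFermiRadius_perturbedFermiRadius B hδc hδ hlo hhi θ
  have ht' := isBandFermiRadius_perturbedFermiRadius B hδc' hδ' hlo hhi θ
  have hmove := hF _ _ ht.mem_Icc ht'.mem_Icc
  have hrad := abs_perturbedFermiRadius_sub_le B hδc hδc' hδ hδ' hlo hhi hL hκ₁ hd
  have h1 : |F (perturbedFermiRadius δ μ θ • dir θ) - F (perturbedFermiRadius δ' μ θ • dir θ)| ≤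
      bF * (d / (B.Dtmin - κ₁)) :=
    hmove.trans (mul_le_mul_of_nonneg_left hrad hbF)
  calc |F (perturbedFermiRadius δ μ θ • dir θ) - F' (perturbedFermiRadius δ' μ θ • dir θ)|
      = |(F (perturbedFermiRadius δ μ θ • dir θ) - F (perturbedFermiRadius δ' μ θ • dir θ)) +
          (F (perturbedFermiRadius δ' μ θ • dir θ) - F' (perturbedFermiRadius δ' μ θ • dir θ))| := by ring_nf
    _ ≤ |F (perturbedFermiRadius δ μ θ • dir θ) - F (perturbedFermiRadius δ' μ θ • dir θ)| +
          |F (perturbedFermiRadius δ' μ θ • dir θ) - F' (perturbedFermiRadius δ' μ θ • dir θ)| := abs_add_le _ _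
    _ ≤ _ := by linarith

end TwoPerturbations

/-! ## §2 Off the curve: the radial distance to the curve is controlled by the perturbed level function -/

/-- **Off-curve radial distance** (radial transversality of the perturbed band): if `|δ| ≤ κ₀` on the closed square,
`[μ − κ₀, μ + κ₀] ⊂ [a, b]`, `δ` is radially `κ₁`-Lipschitz on the segment of the ray `θ`, `t` is a Fermi point of `ε₀ + δ` at level
`μ` on that ray, and `s` is a point of the segment whose FREE level `ε₀(s·dir θ)` lies in `[a, b]`, then
`(Dt_min − κ₁)·|s − t| ≤ |ε₀(s·dir θ) + δ(s·dir θ) − μ|`: for `t ≤ s`,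
`Dt_min (s − t) ≤ ε₀(s) − ε₀(t) = (ε₀ + δ − μ)(s) − (δ(s) − δ(t)) ≤ |e_δ(s)| + κ₁ (s − t)`, and symmetrically. [folklore] -/
theorem mul_abs_sub_le_abs_level_of_shifted {a b : ℝ} (B : BandBounds a b) {δ : (Fin 2 → ℝ) → ℝ} {κ₀ κ₁ μ θ : ℝ}
    (hδ : ∀ k : Fin 2 → ℝ, (∀ i, |k i| ≤ π) → |δ k| ≤ κ₀) (hlo : a ≤ μ - κ₀) (hhi : μ + κ₀ ≤ b)
    (hL : ∀ s t : ℝ, s ∈ Icc 0 (π / ‖dir θ‖) → t ∈ Icc 0 (π / ‖dir θ‖) →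
      |δ (s • dir θ) - δ (t • dir θ)| ≤ κ₁ * |s - t|)
    {t : ℝ} (ht : IsBandFermiRadius (μ - δ (t • dir θ)) θ t)
    {s : ℝ} (hs0 : 0 ≤ s) (hs1 : s * ‖dir θ‖ ≤ π) (hs : rayDispersion (θ, s) ∈ Icc a b) :
    (B.Dtmin - κ₁) * |s - t| ≤ |rayDispersion (θ, s) + δ (s • dir θ) - μ| := by
  have hm := shiftedLevel_mem_Icc ht hδ hlo hhi
  have hsI : s ∈ Icc 0 (π / ‖dir θ‖) := mem_Icc_exit_iff.2 ⟨hs0, hs1⟩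
  have hlip := abs_le.1 (hL s t hsI ht.mem_Icc)
  have hE1 := le_abs_self (rayDispersion (θ, s) + δ (s • dir θ) - μ)
  have hE2 := neg_le_abs (rayDispersion (θ, s) + δ (s • dir θ) - μ)
  rcases le_total s t with h | h
  · have hgrow := Dtmin_mul_sub_le_rayDispersion_sub B hs0 h ht.1.2 hs.1 (by rw [ht.2]; exact hm.2)
    rw [ht.2] at hgrow
    have habs : |s - t| = -(s - t) := abs_of_nonpos (sub_nonpos.2 h)
    rw [habs] at hlip ⊢
    nlinarith [hlip.1, hlip.2]
  · have hgrow := Dtmin_mul_sub_le_rayDispersion_sub B ht.1.1 h hs1 (by rw [ht.2]; exact hm.1) hs.2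
    rw [ht.2] at hgrow
    have habs : |s - t| = s - t := abs_of_nonneg (sub_nonneg.2 h)
    rw [habs] at hlip ⊢
    nlinarith [hlip.1, hlip.2]

section OffCurve

variable {a b : ℝ} (B : BandBounds a b) {δ : (Fin 2 → ℝ) → ℝ} (hδc : Continuous δ) {κ₀ κ₁ μ : ℝ}
  (hδ : ∀ k : Fin 2 → ℝ, (∀ i, |k i| ≤ π) → |δ k| ≤ κ₀) (hlo : a ≤ μ - κ₀) (hhi : μ + κ₀ ≤ b) {θ : ℝ}
  (hL : ∀ s t : ℝ, s ∈ Icc 0 (π / ‖dir θ‖) → t ∈ Icc 0 (π / ‖dir θ‖) →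
    |δ (s • dir θ) - δ (t • dir θ)| ≤ κ₁ * |s - t|)
  (hκ₁ : κ₁ < B.Dtmin) {s : ℝ} (hs0 : 0 ≤ s) (hs1 : s * ‖dir θ‖ ≤ π) (hs : rayDispersion (θ, s) ∈ Icc a b)
include B hδc hδ hlo hhi hL hκ₁ hs0 hs1 hs

/-- **Radial distance to the perturbed Fermi curve ≤ perturbed level / (Dt_min − κ₁)**: for a point `s·dir θ` of the segment whose
free level lies in `[a, b]`, `|s − u_δ(θ)| ≤ |ε₀(s·dir θ) + δ(s·dir θ) − μ| / (Dt_min − κ₁)`.  (With `δ = −K` the right-hand side is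
`|e_K(s·dir θ)|/(Dt_min − κ₁)`: on the scale-`n` shell `|e_K| ≤ Λ_n` the momenta sit within `Λ_n/(Dt_min − κ₁)` of the curve point of
their own ray — the geometric half of (E3e).) [folklore] -/
theorem abs_sub_perturbedFermiRadius_le_abs_level :
    |s - perturbedFermiRadius δ μ θ| ≤ |rayDispersion (θ, s) + δ (s • dir θ) - μ| / (B.Dtmin - κ₁) := by
  have ht := isBandFermiRadius_perturbedFermiRadius B hδc hδ hlo hhi θ
  rw [le_div_iff₀ (sub_pos.2 hκ₁), mul_comm]
  exact mul_abs_sub_le_abs_level_of_shifted B hδ hlo hhi hL ht hs0 hs1 hs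

/-- **Reading a radially Lipschitz function off the curve**: if `F` is radially `b_F`-Lipschitz on the segment of the ray `θ`
(`b_F ≥ 0`), then `|F(s·dir θ) − F(u_δ(θ)·dir θ)| ≤ b_F·|ε₀(s·dir θ) + δ(s·dir θ) − μ| / (Dt_min − κ₁)` — the value of `F` at a
momentum of the tube differs from its value at the curve point of the same ray by the NORMAL SLOPE times the level ((E3e)'s shape).
[folklore] -/
theorem abs_apply_sub_apply_perturbedFermiRadius_le {F : (Fin 2 → ℝ) → ℝ} {bF : ℝ} (hbF : 0 ≤ bF)
    (hF : ∀ s t : ℝ, s ∈ Icc 0 (π / ‖dir θ‖) → t ∈ Icc 0 (π / ‖dir θ‖) →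
      |F (s • dir θ) - F (t • dir θ)| ≤ bF * |s - t|) :
    |F (s • dir θ) - F (perturbedFermiRadius δ μ θ • dir θ)| ≤
      bF * (|rayDispersion (θ, s) + δ (s • dir θ) - μ| / (B.Dtmin - κ₁)) := by
  have ht := isBandFermiRadius_perturbedFermiRadius B hδc hδ hlo hhi θ
  have hsI : s ∈ Icc 0 (π / ‖dir θ‖) := mem_Icc_exit_iff.2 ⟨hs0, hs1⟩
  exact (hF _ _ hsI ht.mem_Icc).trans (mul_le_mul_of_nonneg_left
    (abs_sub_perturbedFermiRadius_le_abs_level B hδc hδ hlo hhi hL hκ₁ hs0 hs1 hs) hbF)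

end OffCurve

end Summit.HubbardSuperconductivity.HubbardSuperconductivity.Theorems.PerturbedFermiCurve

end
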